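import Summits.HodgeConjecture.CorCM.DihedralReflexSwapReflect
import Summits.HodgeConjecture.CorCM.ImaginaryQuadraticTimesSimpleCMSurfaceHodge
import Literature.FieldTheory.AlgClosed.AutFixedSubfield
import HarnessLib

/-!
# Galois closures of quartic CM fields with primitive types meet every other Galois field in a TOTALLY REAL field —
# unless they are contained in it

COR-CM (cell `pub-hodgecm2`, seat p2 gen 18, count-neutral claim CLOSURE-BOUND (F6a)); NEW as stated, hence under
`Summits/`.  Theorems only; no definition, no named fact, no `sorry`.

THE FACT.  Let `K` be a quartic CM field carrying a primitive CM type — i.e. `K` is NOT Galois over `ℚ` (dihedral octic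
Galois closure `L`, Shimura §8.4 (2)(C)) or `K` is Galois with CYCLIC group (`L = K`; a biquadratic CM field has no primitive
type, the tree's `QuarticCM.isCyclic_of_isPrimitive`).  Then **every subfield `F ⊂ ℂ` stable under `Aut(ℂ)` (= normal over
`ℚ`) which contains a NON-REAL element of `L` contains `L`** (`normalClosure_le_of_stable_of_conj_ne`; cyclic:
`normalClosure_le_of_stable_of_conj_ne_of_isCyclic`, where no stability is needed).  Group-theoretically: every non-trivial normal subgroup of `D₄`
(resp. `C₄`) contains the central involution `ρ`, so every proper Galois subfield of `L` is fixed by complex conjugation.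
The proof here is elementary, inside `Aut(ℂ)`: if `L ⊄ F`, an automorphism `γ` of `ℂ` fixes the countable field `F ∩ L`
pointwise and moves some `z ∈ L ∖ F` (`Literature.FieldTheory.AlgClosed.Complex.exists_ringEquiv_fix_apply_ne`); `γ` then
acts non-trivially on `Hom(K, ℂ) = {a, ā, b, b̄}`, as one of the seven non-trivial admissible couples `(γa, γb)`, and in each
case one of `γ`, `γ²`, `γ·(τγτ⁻¹)` (`τ` Shimura's `4`-cycle) acts as COMPLEX CONJUGATION on `Hom(K, ℂ)`
(`exists_conjLike_of_ne`), while still fixing `F ∩ L` pointwise (`F ∩ L` is `τ`-stable) — so `x̄ = x` for every `x ∈ F ∩ L`.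

CONSEQUENCES (`L₀ = normalClosure ℚ K₀ ℂ`, `L₁ = normalClosure ℚ K₁ ℂ`, `K₀` quartic CM with a primitive type, `K₁` ANY
number field):
* `conj_apply_eq_of_mem_inf_of_not_le` — either `L₀ ≤ L₁`, or complex conjugation fixes `L₀ ∩ L₁` pointwise; hence
  (`conj_apply_eq_of_mem_inf_of_not_dvd`) the latter as soon as `[L₀ : ℚ] ∤ [L₁ : ℚ]` (e.g. `K₀` non-Galois and `8 ∤ [L₁:ℚ]`:
  all CM elliptic curves, cyclic quartic and cyclic sextic fields, sextic fields with closure of degree `12`, …).  With b23's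
  two-slot criterion (`exists_pairConj_of_conj_apply_eq`): a PARTIAL CONJUGATION exists for the pair `(K₀, K₁)`, so a simple
  CM abelian surface of dihedral type SPLITS OFF every CM abelian variety whose Galois closure has degree not divisible by `8`
  (rank additivity, `CMTypeRankPartialConjugation`).
* `normalClosure_eq_of_conj_ne` — two non-Galois quartic CM fields whose closures meet in a non-real field have the SAME
  closure (then `DihedralReflexPairCMHodge` / `QuarticCMTypePairNondegenerate` take over);
  `conj_apply_eq_of_mem_inf_of_isGalois` — a non-Galois and a Galois quartic CM field always meet in a real field;
  `normalClosure_eq_of_conj_ne_of_isCyclic` — two cyclic quartic CM fields meeting in a non-real field have the same image.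
These are the case distinctions of `TwoSimpleCMSurfacesHodge` (F6b: ANY two simple CM abelian surfaces form a nondegenerate
pair).

## References

* [Shimura1998] G. Shimura, *Abelian Varieties with Complex Multiplication and Modular Functions*, §8.4 Example (2)(B), (C).
* [MoonenZarhin1999LowDim] B. Moonen, Yu. Zarhin, *Hodge classes on abelian varieties of low dimension*, Math. Ann. 315
  (1999), "Hodge groups of simple abelian surfaces of CM-type".
* [Lang2002] S. Lang, *Algebra*, VI §1 (Galois correspondence; Thm. 1.14).
-/

noncomputable section

open NumberField NumberField.ComplexEmbedding IntermediateField
open scoped Cardinal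

namespace Summit.HodgeConjecture.CorCM

open Literature.NumberTheory.ComplexMultiplication
open Literature.AlgebraicGeometry.Motives (CMType)
open Literature.AlgebraicGeometry.Pohlmann1968
open Summit.HodgeConjecture.CorCM.CyclicSextic (conjugate_eq_comp_conjGal)
open QuarticCM

namespace QuarticCMClosure

/-! ### §1 Normal closures in `ℂ` are `Aut(ℂ)`-stable; automorphisms fixing a subfield of one -/

section General

variable {K : Type} [Field K] [NumberField K]

/-- The Galois closure `normalClosure ℚ K ℂ` of a number field in `ℂ` is stable under every automorphism of `ℂ` (it is the
compositum of the images of ALL embeddings, which `Aut(ℂ)` permutes). [cite: Lang2002, V §3 Thm. 3.3] -/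
theorem smul_mem_normalClosure (γ : ℂ ≃+* ℂ) {y : ℂ} (hy : y ∈ normalClosure ℚ K ℂ) : γ y ∈ normalClosure ℚ K ℂ := by
  let φ : ℂ →ₐ[ℚ] ℂ := (AlgEquiv.ofRingEquiv (f := γ) fun q => by simp).toAlgHom
  have hle : normalClosure ℚ K ℂ ≤ (normalClosure ℚ K ℂ).comap φ := by
    refine normalClosure_le_iff.2 fun f => ?_
    rintro _ ⟨z, rfl⟩
    change φ (f z) ∈ normalClosure ℚ K ℂ
    exact (φ.comp f).fieldRange_le_normalClosure ⟨z, rfl⟩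
  exact hle hy

/-- An `Aut(ℂ)`-stable subfield `F` meets the Galois closure `L` of `K` in a `τ`-stable set: `y ∈ F ∩ L ⟹ τ⁻¹y ∈ F ∩ L`;
hence an automorphism `γ` fixing `F ∩ L` pointwise has `τγτ⁻¹` fixing `F ∩ L` pointwise too. [cite: Lang2002, VI §1 Thm. 1.14] -/
theorem conj_apply_eq_self_of_forall (F : IntermediateField ℚ ℂ) (hF : ∀ (γ : ℂ ≃+* ℂ) (y : ℂ), y ∈ F → γ y ∈ F)
    {γ : ℂ ≃+* ℂ} (hγ : ∀ y : ℂ, y ∈ F → y ∈ normalClosure ℚ K ℂ → γ y = y) (τ : ℂ ≃+* ℂ) {y : ℂ} (hyF : y ∈ F)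
    (hyL : y ∈ normalClosure ℚ K ℂ) : (τ * γ * τ⁻¹) y = y := by
  have h1 : γ (τ⁻¹ y) = τ⁻¹ y := hγ _ (hF τ⁻¹ y hyF) (smul_mem_normalClosure τ⁻¹ hyL)
  change τ (γ (τ⁻¹ y)) = y
  rw [h1, show τ⁻¹ = τ.symm from rfl, τ.apply_symm_apply]

/-- `F ∩ L` is countable (`L` a number field inside `ℂ`), as a subfield of `ℂ`. [folklore] -/
private theorem cardinalMk_inf_le_aleph0 (F : IntermediateField ℚ ℂ) :
    #↥(F ⊓ normalClosure ℚ K ℂ).toSubfield ≤ ℵ₀ := by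
  haveI : FiniteDimensional ℚ ↥(F ⊓ normalClosure ℚ K ℂ) :=
    FiniteDimensional.of_injective
      (IntermediateField.inclusion (inf_le_right : F ⊓ normalClosure ℚ K ℂ ≤ normalClosure ℚ K ℂ)).toLinearMap
      (IntermediateField.inclusion_injective (inf_le_right : F ⊓ normalClosure ℚ K ℂ ≤ normalClosure ℚ K ℂ))
  haveI : Algebra.IsAlgebraic ℚ ↥(F ⊓ normalClosure ℚ K ℂ).toSubfield :=
    Algebra.IsAlgebraic.of_finite ℚ ↥(F ⊓ normalClosure ℚ K ℂ)
  exact Literature.FieldTheory.AlgClosed.Subfield.cardinalMk_le_aleph0_of_isAlgebraic _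

/-- If `L ⊄ F` then some automorphism of `ℂ` fixes `F ∩ L` pointwise and moves an element of `L` (the fixed field of
`Aut(ℂ/F ∩ L)` is the countable field `F ∩ L`). [cite: Lang2002, VI §1 Thm. 1.14] -/
theorem exists_ringAut_fix_inf_apply_ne (F : IntermediateField ℚ ℂ) (hnle : ¬normalClosure ℚ K ℂ ≤ F) :
    ∃ (γ : ℂ ≃+* ℂ) (z : ℂ), z ∈ normalClosure ℚ K ℂ ∧ γ z ≠ z ∧
      ∀ y : ℂ, y ∈ F → y ∈ normalClosure ℚ K ℂ → γ y = y := by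
  obtain ⟨z, hzL, hzF⟩ := Set.not_subset.1 (show ¬((normalClosure ℚ K ℂ : Set ℂ) ⊆ F) from hnle)
  have hz : z ∉ (F ⊓ normalClosure ℚ K ℂ).toSubfield := fun h =>
    hzF ((IntermediateField.mem_inf.1 ((IntermediateField.mem_toSubfield _ _).1 h)).1)
  obtain ⟨γ, hfix, hne⟩ :=
    Literature.FieldTheory.AlgClosed.Complex.exists_ringEquiv_fix_apply_ne _ (cardinalMk_inf_le_aleph0 (K := K) F) hz
  exact ⟨γ, z, hzL, hne, fun y hyF hyL =>
    hfix y ((IntermediateField.mem_toSubfield _ _).2 (IntermediateField.mem_inf.2 ⟨hyF, hyL⟩))⟩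

end General

/-! ### §2 The dihedral case: an automorphism moving `Hom(K, ℂ)` yields one acting as complex conjugation -/

section Dihedral

variable {K : Type} [Field K] [NumberField K] [IsCMField K]

/-- **The `δ`-trick.**  `K` a quartic CM field, `b ∉ {a, ā}`, `τ` the `4`-cycle (`τa = b`, `τb = ā`).  If `γ ∈ Aut(ℂ)` does
not fix both `a` and `b`, then one of `γ`, `γ²`, `γ(τγτ⁻¹)` acts as complex conjugation on `a` and `b` — the case list of
the seven non-trivial admissible couples `(γa, γb)`: `ρ` itself; `τ^{±1}` square to `ρ`; a reflection `s` times its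
`τ`-conjugate `τsτ⁻¹ = ρs` is `ρ`.  (Every non-trivial normal subgroup of `D₄` contains the centre.)
[cite: Shimura1998, §8.4 Example (2)(C)] -/
theorem exists_conjLike_of_ne (h4 : Module.finrank ℚ K = 4) {a b : K →+* ℂ} (hba : b ≠ a) (hba' : b ≠ conjugate a)
    {τ : ℂ ≃+* ℂ} (hτa : τ • a = b) (hτb : τ • b = conjugate a) {γ : ℂ ≃+* ℂ} (hγ : ¬(γ • a = a ∧ γ • b = b)) :
    ∃ δ : ℂ ≃+* ℂ, (δ = γ ∨ δ = γ * γ ∨ δ = γ * (τ * γ * τ⁻¹)) ∧ δ • a = conjugate a ∧ δ • b = conjugate b := by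
  have hcc : conjugate b ≠ conjugate a := fun h => hba ((involutive_conjugate K).injective h)
  have hab' : conjugate b ≠ a := fun h => hba' (by rw [← h, involutive_conjugate])
  -- `τ⁻¹ a = b̄`, `τ⁻¹ b = a`, `τ ā = b̄`, `τ b̄ = a`
  have hτa' : τ • conjugate a = conjugate b := by rw [smul_conjugate, hτa]
  have hτb' : τ • conjugate b = a := by rw [smul_conjugate, hτb, involutive_conjugate]
  have hτia : τ⁻¹ • a = conjugate b := by rw [inv_smul_eq_iff, hτb']
  have hτib : τ⁻¹ • b = a := by rw [inv_smul_eq_iff, hτa]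
  -- the conjugate `τγτ⁻¹` evaluated at `a` and `b`
  have hca : (τ * γ * τ⁻¹) • a = τ • γ • conjugate b := by rw [mul_smul, mul_smul, hτia]
  have hcb : (τ * γ * τ⁻¹) • b = τ • γ • a := by rw [mul_smul, mul_smul, hτib]
  rcases eq_or_eq_or_eq_or_eq h4 hba hba' (γ • a) with ha | ha | ha | ha <;>
    rcases eq_or_eq_or_eq_or_eq h4 hba hba' (γ • b) with hb | hb | hb | hb
  -- `γa = a`
  · exact absurd (smul_left_cancel γ (hb.trans ha.symm)) hba
  · exact absurd (smul_left_cancel γ (show γ • b = γ • conjugate a by rw [smul_conjugate, ha, hb])) hba'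
  · exact absurd ⟨ha, hb⟩ hγ
  · -- `(a, b̄)`: `σ₀`-like
    refine ⟨γ * (τ * γ * τ⁻¹), Or.inr (Or.inr rfl), ?_, ?_⟩
    · rw [mul_smul, hca, smul_conjugate, hb, involutive_conjugate, hτb, smul_conjugate, ha]
    · rw [mul_smul, hcb, ha, hτa, hb]
  -- `γa = ā`
  · exact absurd (smul_left_cancel γ (show γ • b = γ • conjugate a by
      rw [smul_conjugate, ha, involutive_conjugate, hb])) hba'
  · exact absurd (smul_left_cancel γ (hb.trans ha.symm)) hba
  · -- `(ā, b)`: `ρσ₀`-like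
    refine ⟨γ * (τ * γ * τ⁻¹), Or.inr (Or.inr rfl), ?_, ?_⟩
    · rw [mul_smul, hca, smul_conjugate, hb, hτb', ha]
    · rw [mul_smul, hcb, ha, hτa', smul_conjugate, hb]
  · -- `(ā, b̄)`: `ρ`-like
    exact ⟨γ, Or.inl rfl, ha, hb⟩
  -- `γa = b`
  · -- `(b, a)`: `τσ₀`-like
    refine ⟨γ * (τ * γ * τ⁻¹), Or.inr (Or.inr rfl), ?_, ?_⟩
    · rw [mul_smul, hca, smul_conjugate, hb, hτa', smul_conjugate, hb]
    · rw [mul_smul, hcb, ha, hτb, smul_conjugate, ha]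
  · -- `(b, ā)`: `τ`-like
    refine ⟨γ * γ, Or.inr (Or.inl rfl), ?_, ?_⟩
    · rw [mul_smul, ha, hb]
    · rw [mul_smul, hb, smul_conjugate, ha]
  · exact absurd (smul_left_cancel γ (hb.trans ha.symm)) hba
  · exact absurd (smul_left_cancel γ (show γ • b = γ • conjugate a by rw [smul_conjugate, ha, hb])) hba'
  -- `γa = b̄`
  · -- `(b̄, a)`: `τ³`-like
    refine ⟨γ * γ, Or.inr (Or.inl rfl), ?_, ?_⟩
    · rw [mul_smul, ha, smul_conjugate, hb]
    · rw [mul_smul, hb, ha]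
  · -- `(b̄, ā)`: `τ³σ₀`-like
    refine ⟨γ * (τ * γ * τ⁻¹), Or.inr (Or.inr rfl), ?_, ?_⟩
    · rw [mul_smul, hca, smul_conjugate, hb, involutive_conjugate, hτa, hb]
    · rw [mul_smul, hcb, ha, hτb', ha]
  · exact absurd (smul_left_cancel γ (show γ • b = γ • conjugate a by
      rw [smul_conjugate, ha, involutive_conjugate, hb])) hba'
  · exact absurd (smul_left_cancel γ (hb.trans ha.symm)) hba

/-- **Non-real elements of the dihedral closure generate it over every Galois field.**  `K` a NON-GALOIS quartic CM
field, `L` its Galois closure in `ℂ`; if an `Aut(ℂ)`-stable subfield `F ⊂ ℂ` contains some `x ∈ L` with `x̄ ≠ x` then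
`L ≤ F`.  (Every proper normal subfield of the dihedral octic CM field `L` is totally real: `Gal(L/F ∩ L)` is a non-trivial
normal subgroup of `D₄`, hence contains `ρ`.) [cite: Shimura1998, §8.4 Example (2)(C)] -/
theorem normalClosure_le_of_stable_of_conj_ne (h4 : Module.finrank ℚ K = 4) (hK : ¬IsGalois ℚ K)
    (F : IntermediateField ℚ ℂ) (hF : ∀ (γ : ℂ ≃+* ℂ) (y : ℂ), y ∈ F → γ y ∈ F) {x : ℂ} (hxF : x ∈ F)
    (hxL : x ∈ normalClosure ℚ K ℂ) (hx : starRingEnd ℂ x ≠ x) : normalClosure ℚ K ℂ ≤ F := by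
  by_contra hnle
  obtain ⟨γ, z, hzL, hγz, hγ⟩ := exists_ringAut_fix_inf_apply_ne (K := K) F hnle
  obtain ⟨a⟩ : Nonempty (K →+* ℂ) := inferInstance
  obtain ⟨b, hba, hba'⟩ := exists_ne_ne_conjugate h4 a
  obtain ⟨τ, hτa, hτb⟩ := exists_ringAut_smul_eq_smul_eq_conjugate h4 hK hba hba'
  -- `γ` moves `a` or `b` (else it fixes `L ∋ z`)
  have hγab : ¬(γ • a = a ∧ γ • b = b) := by
    rintro ⟨ha, hb⟩
    have hall : ∀ s : K →+* ℂ, γ • s = s := fun s => by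
      have := DihedralReflexPair.forall_smul_eq_of_pair h4 hba hba' (γ' := 1) (by rw [ha, one_smul])
        (by rw [hb, one_smul]) s
      rwa [one_smul] at this
    exact hγz (apply_eq_self_of_mem_normalClosure hall hzL)
  obtain ⟨δ, hδ, hδa, hδb⟩ := exists_conjLike_of_ne h4 hba hba' hτa hτb hγab
  -- `δ` is complex conjugation on `L`
  have hδL : δ x = starRingEnd ℂ x := by
    have hall : ∀ s : K →+* ℂ, ((starRingAut : ℂ ≃+* ℂ)⁻¹ * δ) • s = s := fun s => by
      rw [mul_smul, inv_smul_eq_iff, conj_smul_eq_conjugate]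
      exact DihedralReflexPair.forall_smul_eq_of_pair h4 hba hba' (γ := δ) (γ' := starRingAut)
        (by rw [hδa, conj_smul_eq_conjugate]) (by rw [hδb, conj_smul_eq_conjugate]) s
    have h1 := apply_eq_self_of_mem_normalClosure hall hxL
    change (starRingAut : ℂ ≃+* ℂ).symm (δ x) = x at h1
    rw [RingEquiv.symm_apply_eq] at h1
    exact h1
  -- but `δ` fixes `x ∈ F ∩ L`
  have hδx : δ x = x := by
    rcases hδ with rfl | rfl | rfl
    · exact hγ x hxF hxL
    · change γ (γ x) = x
      rw [hγ x hxF hxL, hγ x hxF hxL]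
    · change γ ((τ * γ * τ⁻¹) x) = x
      rw [conj_apply_eq_self_of_forall F hF hγ τ hxF hxL, hγ x hxF hxL]
  exact hx (hδL.symm.trans hδx)

end Dihedral

/-! ### §3 The cyclic case -/

section Cyclic

variable {K : Type} [Field K] [NumberField K] [IsCMField K]

/-- **The `δ`-trick, cyclic case.**  `K` a quartic CM field, Galois with CYCLIC group; if `γ ∈ Aut(ℂ)` moves some
embedding of `K` then `γ` or `γ²` acts as complex conjugation on every embedding (`γ` acts as a twist `w ∈ Gal(K/ℚ)`,
`w ≠ 1`; `w = c` or `w² = c`). [cite: Shimura1998, §8.4 Example (2)(B)] -/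
theorem exists_conjLike_of_ne_of_isCyclic [IsGalois ℚ K] (h4 : Module.finrank ℚ K = 4) (hcyc : IsCyclic (K ≃ₐ[ℚ] K))
    {a : K →+* ℂ} {γ : ℂ ≃+* ℂ} (hγ : γ • a ≠ a) :
    ∃ δ : ℂ ≃+* ℂ, (δ = γ ∨ δ = γ * γ) ∧ ∀ s : K →+* ℂ, δ • s = conjugate s := by
  obtain ⟨w, hw⟩ := exists_eq_comp_algEquiv a (γ • a)
  have hw1 : w ≠ 1 := fun h => hγ (by rw [hw, h]; rfl)
  have key : ∀ (v : K ≃ₐ[ℚ] K), γ • a.comp v.toRingEquiv.toRingHom = a.comp (w * v).toRingEquiv.toRingHom := fun v => by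
    rw [smul_comp_algEquiv, hw, comp_algEquiv_comp]
  by_cases hwc : w = conjGal
  · refine ⟨γ, Or.inl rfl, fun s => ?_⟩
    obtain ⟨v, rfl⟩ := exists_eq_comp_algEquiv a s
    rw [key, hwc, (commute_conjGal v).eq, ← comp_algEquiv_comp, ← conjugate_eq_comp_conjGal]
  · have hww : w * w = conjGal := mul_self_eq_conjGal_of_isCyclic h4 hcyc hw1 hwc
    refine ⟨γ * γ, Or.inr rfl, fun s => ?_⟩
    obtain ⟨v, rfl⟩ := exists_eq_comp_algEquiv a s
    rw [mul_smul, key, key, ← mul_assoc, hww, (commute_conjGal v).eq, ← comp_algEquiv_comp, ← conjugate_eq_comp_conjGal]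

/-- **Cyclic case: a subfield of `ℂ` containing a non-real element of (the image `L` of) a cyclic quartic CM field `K`
contains `L`** — no stability needed (the only proper subfields of `K` are `ℚ` and the real `K⁺`, so a non-real element
generates `K`). [cite: Shimura1998, §8.4 Example (2)(B)] -/
theorem normalClosure_le_of_stable_of_conj_ne_of_isCyclic [IsGalois ℚ K] (h4 : Module.finrank ℚ K = 4)
    (hcyc : IsCyclic (K ≃ₐ[ℚ] K)) (F : IntermediateField ℚ ℂ)
    {x : ℂ} (hxF : x ∈ F) (hxL : x ∈ normalClosure ℚ K ℂ) (hx : starRingEnd ℂ x ≠ x) : normalClosure ℚ K ℂ ≤ F := by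
  by_contra hnle
  obtain ⟨γ, z, hzL, hγz, hγ⟩ := exists_ringAut_fix_inf_apply_ne (K := K) F hnle
  obtain ⟨a⟩ : Nonempty (K →+* ℂ) := inferInstance
  -- `γ` moves `a` (else it fixes every `a ∘ w`, hence `L ∋ z`)
  have hγa : γ • a ≠ a := by
    intro ha
    have hall : ∀ s : K →+* ℂ, γ • s = s := fun s => by
      obtain ⟨v, rfl⟩ := exists_eq_comp_algEquiv a s
      rw [smul_comp_algEquiv, ha]
    exact hγz (apply_eq_self_of_mem_normalClosure hall hzL)
  obtain ⟨δ, hδ, hδs⟩ := exists_conjLike_of_ne_of_isCyclic h4 hcyc hγa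
  have hδL : δ x = starRingEnd ℂ x := by
    have hall : ∀ s : K →+* ℂ, ((starRingAut : ℂ ≃+* ℂ)⁻¹ * δ) • s = s := fun s => by
      rw [mul_smul, inv_smul_eq_iff, conj_smul_eq_conjugate, hδs]
    have h1 := apply_eq_self_of_mem_normalClosure hall hxL
    change (starRingAut : ℂ ≃+* ℂ).symm (δ x) = x at h1
    rw [RingEquiv.symm_apply_eq] at h1
    exact h1
  have hδx : δ x = x := by
    rcases hδ with rfl | rfl
    · exact hγ x hxF hxL
    · change γ (γ x) = x
      rw [hγ x hxF hxL, hγ x hxF hxL]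
  exact hx (hδL.symm.trans hδx)

end Cyclic

/-! ### §4 Consequences: real intersections or containment -/

section Consequences

variable {K₀ K₁ : Type} [Field K₀] [NumberField K₀] [IsCMField K₀] [Field K₁] [NumberField K₁]

/-- **Dichotomy for a non-Galois quartic CM field `K₀` and ANY number field `K₁`**: either the Galois closure of `K₀` is
contained in that of `K₁`, or complex conjugation fixes `L₀ ∩ L₁` pointwise (the intersection is totally real).
[cite: Shimura1998, §8.4 Example (2)(C)] -/
theorem conj_apply_eq_of_mem_inf_of_not_le (h4 : Module.finrank ℚ K₀ = 4) (hK : ¬IsGalois ℚ K₀)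
    (hnle : ¬normalClosure ℚ K₀ ℂ ≤ normalClosure ℚ K₁ ℂ) {x : ℂ} (hx₀ : x ∈ normalClosure ℚ K₀ ℂ)
    (hx₁ : x ∈ normalClosure ℚ K₁ ℂ) : starRingEnd ℂ x = x := by
  by_contra hx
  exact hnle (normalClosure_le_of_stable_of_conj_ne h4 hK (normalClosure ℚ K₁ ℂ)
    (fun γ _ hy => smul_mem_normalClosure γ hy) hx₁ hx₀ hx)

omit [IsCMField K₀] in
/-- `L₀ ≤ L₁` forces `[L₀ : ℚ] ∣ [L₁ : ℚ]`. [folklore] -/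
private theorem finrank_dvd_of_le {L₀ L₁ : IntermediateField ℚ ℂ} (h : L₀ ≤ L₁) :
    Module.finrank ℚ L₀ ∣ Module.finrank ℚ L₁ :=
  Dvd.intro _ (IntermediateField.finrank_bot_mul_relfinrank h)

/-- **A non-Galois quartic CM field meets every Galois field of degree not divisible by `8` in a totally real field**: if
`8 ∤ [L₁ : ℚ]` then complex conjugation fixes `L₀ ∩ L₁` pointwise — so b23's two-slot criterion yields a partial
conjugation for the pair `(K₀, K₁)` and the ranks add (`CMTypeRankPartialConjugation`): a simple CM abelian surface of
dihedral type splits off every CM abelian variety whose Galois closure has degree prime to… not divisible by `8` (CM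
elliptic curves, cyclic quartic surfaces, all simple CM threefolds with closures of degree `6` or `12`, …).
[cite: Shimura1998, §8.4 Example (2)(C)] [cite: Lang2002, VI §1 Thm. 1.14] -/
theorem conj_apply_eq_of_mem_inf_of_not_dvd (h4 : Module.finrank ℚ K₀ = 4) (hK : ¬IsGalois ℚ K₀)
    (h8 : ¬(8 ∣ Module.finrank ℚ ↥(normalClosure ℚ K₁ ℂ))) {x : ℂ} (hx₀ : x ∈ normalClosure ℚ K₀ ℂ)
    (hx₁ : x ∈ normalClosure ℚ K₁ ℂ) : starRingEnd ℂ x = x := by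
  refine conj_apply_eq_of_mem_inf_of_not_le h4 hK (fun hle => h8 ?_) hx₀ hx₁
  rw [← DihedralReflexPair.finrank_normalClosure_eq_eight h4 hK]
  exact finrank_dvd_of_le hle

/-- **A non-Galois and a Galois quartic CM field meet in a totally real field** (the dihedral octic closure does not fit
into a quartic field). [cite: Shimura1998, §8.4 Example (2)(B), (C)] -/
theorem conj_apply_eq_of_mem_inf_of_isGalois (h4 : Module.finrank ℚ K₀ = 4) (hK : ¬IsGalois ℚ K₀) [IsGalois ℚ K₁]
    (h4₁ : Module.finrank ℚ K₁ = 4) {x : ℂ} (hx₀ : x ∈ normalClosure ℚ K₀ ℂ) (hx₁ : x ∈ normalClosure ℚ K₁ ℂ) :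
    starRingEnd ℂ x = x := by
  refine conj_apply_eq_of_mem_inf_of_not_dvd h4 hK (fun h8 => ?_) hx₀ hx₁
  rw [finrank_normalClosure_of_normal, h4₁] at h8
  omega

/-- **Two non-Galois quartic CM fields whose Galois closures meet in a NON-real field have the same Galois closure**
(both closures contain each other). [cite: Shimura1998, §8.4 Example (2)(C)] -/
theorem normalClosure_eq_of_conj_ne [IsCMField K₁] (h4₀ : Module.finrank ℚ K₀ = 4) (hK₀ : ¬IsGalois ℚ K₀)
    (h4₁ : Module.finrank ℚ K₁ = 4) (hK₁ : ¬IsGalois ℚ K₁) {x : ℂ} (hx₀ : x ∈ normalClosure ℚ K₀ ℂ)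
    (hx₁ : x ∈ normalClosure ℚ K₁ ℂ) (hx : starRingEnd ℂ x ≠ x) : normalClosure ℚ K₀ ℂ = normalClosure ℚ K₁ ℂ :=
  le_antisymm
    (normalClosure_le_of_stable_of_conj_ne h4₀ hK₀ _ (fun γ _ hy => smul_mem_normalClosure γ hy) hx₁ hx₀ hx)
    (normalClosure_le_of_stable_of_conj_ne h4₁ hK₁ _ (fun γ _ hy => smul_mem_normalClosure γ hy) hx₀ hx₁ hx)

/-- **Cyclic dichotomy**: for `K₀` a cyclic quartic CM field and any number field `K₁`, either `L₀ ≤ L₁` or complex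
conjugation fixes `L₀ ∩ L₁` pointwise. [cite: Shimura1998, §8.4 Example (2)(B)] -/
theorem conj_apply_eq_of_mem_inf_of_not_le_of_isCyclic [IsGalois ℚ K₀] (h4 : Module.finrank ℚ K₀ = 4)
    (hcyc : IsCyclic (K₀ ≃ₐ[ℚ] K₀)) (hnle : ¬normalClosure ℚ K₀ ℂ ≤ normalClosure ℚ K₁ ℂ) {x : ℂ}
    (hx₀ : x ∈ normalClosure ℚ K₀ ℂ) (hx₁ : x ∈ normalClosure ℚ K₁ ℂ) : starRingEnd ℂ x = x := by
  by_contra hx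
  exact hnle (normalClosure_le_of_stable_of_conj_ne_of_isCyclic h4 hcyc (normalClosure ℚ K₁ ℂ) hx₁ hx₀ hx)

/-- **Two cyclic quartic CM fields whose images meet in a NON-real field have the same image** (`L_i = s_i(K_i)`).
[cite: Shimura1998, §8.4 Example (2)(B)] -/
theorem normalClosure_eq_of_conj_ne_of_isCyclic [IsCMField K₁] [IsGalois ℚ K₀] [IsGalois ℚ K₁]
    (h4₀ : Module.finrank ℚ K₀ = 4) (hc₀ : IsCyclic (K₀ ≃ₐ[ℚ] K₀)) (h4₁ : Module.finrank ℚ K₁ = 4)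
    (hc₁ : IsCyclic (K₁ ≃ₐ[ℚ] K₁)) {x : ℂ} (hx₀ : x ∈ normalClosure ℚ K₀ ℂ) (hx₁ : x ∈ normalClosure ℚ K₁ ℂ)
    (hx : starRingEnd ℂ x ≠ x) : normalClosure ℚ K₀ ℂ = normalClosure ℚ K₁ ℂ :=
  le_antisymm
    (normalClosure_le_of_stable_of_conj_ne_of_isCyclic h4₀ hc₀ _ hx₁ hx₀ hx)
    (normalClosure_le_of_stable_of_conj_ne_of_isCyclic h4₁ hc₁ _ hx₀ hx₁ hx)

omit [IsCMField K₀] in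
/-- **A cyclic and a non-Galois quartic CM field meet in a totally real field** (symmetric reading of
`conj_apply_eq_of_mem_inf_of_isGalois`). [cite: Shimura1998, §8.4 Example (2)(B), (C)] -/
theorem conj_apply_eq_of_mem_inf_of_isGalois' [IsCMField K₁] [IsGalois ℚ K₀] (h4₀ : Module.finrank ℚ K₀ = 4)
    (h4₁ : Module.finrank ℚ K₁ = 4) (hK₁ : ¬IsGalois ℚ K₁) {x : ℂ} (hx₀ : x ∈ normalClosure ℚ K₀ ℂ)
    (hx₁ : x ∈ normalClosure ℚ K₁ ℂ) : starRingEnd ℂ x = x :=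
  conj_apply_eq_of_mem_inf_of_isGalois h4₁ hK₁ h4₀ hx₁ hx₀

end Consequences

end QuarticCMClosure

end Summit.HodgeConjecture.CorCM

end
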